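import Literature.AlgebraicGeometry.Frobenioids.PadicFrobenioidUnitGroups
import HarnessLib

/-!
# Frobenioids II, Theorem 1.2 (v), preliminaries: the monoid `τ_p(A) ⊆ O^▷(A)` of a `p`-adic Frobenioid

Mochizuki, *The geometry of Frobenioids II*, Kyushu J. Math. **62** (2008) 401–460, §1, Theorem 1.2 (v),
p. 9, with its proof p. 10 [cite: MochizukiFrdII2008, Thm 1.2 (v) pp.9-10]: "Suppose that `Φ` is
absolutely primitive. … the element `p ∈ ℚ_p^×` determines a characteristic splitting [cf. [FrdI],
Definition 2.3] on `C`", proof: "the image of `p ∈ ℚ_p^×` in `K^×` [for `Spec(K) ∈ Ob(D₀)`] determines a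
characteristic splitting."

For the `p`-adic Frobenioid `C = d.frobenioid` of a `PadicFrd.Datum` (abc-iut-L1-t4, `PadicFrobenioid.lean`)
this file sets up the printed splitting as a family of submonoids and proves the parts of [FrdI] Def. 2.3
that hold WITHOUT absolute primitivity:

* the components `ι_A : Φ(A) ↪ Φ₀(A)` (`ιHom`) and `B(A) → K_A^×` (`resK`) of the datum over the concrete
  monoids, the element `p ∈ K_A^×` (`primeUnit`), and the algebra of base-identity linear endomorphisms
  `e = (1, id, Div e, u_e)` of `A = (A_D, α)` (`Div e = Div_B(u_e)`; composites multiply `u`; an element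
  of `O^▷(A)` is determined by `u_e`; the rational function of a unit of `O^▷(A)` lies in `O_{K_A}^×`);
* `pSplittingSubmonoid X` — **`τ_p(A) ⊆ O^▷(A)`**: the base-identity linear endomorphisms whose rational
  function restricted to `K_A^×` is a power of `p`;
* `mem_pSplittingSubmonoid_of_comp_eq` — `τ_p` is a subfunctor of `O^▷(−)` on linear morphisms (field
  homomorphisms fix `p`); `exists_comp_eq_of_isLinear` — Def. 2.3 (b) for every linear morphism (in
  particular for isotropic hulls); `eq_of_associated` — `τ_p(A) → O^▷(A)^char` is injective.

Surjectivity of `τ_p(A) → O^▷(A)^char` (which needs absolute primitivity), the resulting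
`PreFrobenioid.CharacteristicSplitting` (abc-iut-L1-t2's typing of [FrdI] Def. 2.3) and Theorem 1.2 (v)
itself are in `PadicFrobenioidSplitting.lean`. Dictionary as in `ModelFrobenioid.lean` (monoids
multiplicative, composition diagrammatic, `End A` multiplies by `f * g = g ≫ f`; endomorphisms are
handled as morphisms `A ⟶ A` via `End.asHom`). No statement of the paper is strengthened.
-/

noncomputable section

namespace Literature.AlgebraicGeometry.Frobenioids

namespace PadicFrd

open CategoryTheory Opposite Function ValuativeRel

universe v u

namespace Datum

variable {D : Type u} [Category.{v} D] {p : ℕ} [Fact p.Prime] (d : Datum D p)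

/-! ### Components of the datum over the concrete monoids `Φ₀(A) = ord(O_K^⊳) ⊗ ℝ_{≥0}`, `B₀(A) = K^×` -/

/-- `ι_A : Φ(A) ↪ Φ₀(A) = ord(O_{K_A}^⊳) ⊗ ℝ_{≥0}`, the component at `A` of the inclusion `Φ ⊆ Φ₀|_D`
(FrdII Ex. 1.1 (ii), p. 8). [cite: MochizukiFrdII2008, Ex 1.1 (ii) p.8] -/
def ιHom (A : D) : d.Φ.obj (op A) →* Realification (OrdInt (d.fld A)) := (d.ι.app (op A)).hom

/-- `ι_A` is injective ("subfunctor"). [cite: MochizukiFrdII2008, Ex 1.1 (ii) p.8] -/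
theorem ιHom_injective (A : D) : Injective (d.ιHom A) := d.ι_injective (op A)

/-- `B(A) → B₀(A) = K_A^×`, the component at `A` of the first projection of the fibre product `B`
(restriction of rational functions to `K_A^×`; FrdII Ex. 1.1 (ii), p. 8). [cite: MochizukiFrdII2008, Ex 1.1 (ii) p.8] -/
def resK (A : D) : d.B.obj (op A) →* (d.fld A)ˣ := (d.toB0.app (op A)).hom

/-- The cartesian square on elements: `Div₀(b|_{K^×}) = ι^gp(Div_B(b))` (abc-iut-L1-d10's `square_apply`,
over the concrete monoids). [cite: MochizukiFrdII2008, Ex 1.1 (ii) p.8] -/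
theorem divZeroHom_resK (A : D) (b : d.B.obj (op A)) :
    divZeroHom (d.fld A) (d.resK A b) = MonGp.map (d.ιHom A) (Frobenioids.divB d.Φ d.B d.divB (op A) b) :=
  d.square_apply (op A) b

/-- An element of `B(A) = K_A^× ×_{Φ₀^gp(A)} Φ^gp(A)` is determined by its two components.
[cite: MochizukiFrdII2008, Ex 1.1 (ii) p.8] -/
theorem resK_ext (A : D) {u u' : d.B.obj (op A)} (h₁ : d.resK A u = d.resK A u')
    (h₂ : Frobenioids.divB d.Φ d.B d.divB (op A) u = Frobenioids.divB d.Φ d.B d.divB (op A) u') : u = u' :=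
  d.B_ext (op A) h₁ h₂

/-- Naturality of `B → B₀|_D` on elements: `(B(f)(u))|_{K^×} = σ_f(u|_{K^×})`, `σ_f : K_{A'} → K_A` the field
homomorphism under `f : A → A'`. [cite: MochizukiFrdII2008, Ex 1.1 (ii) p.8] -/
theorem resK_mapB {A A' : D} (f : A ⟶ A') (u : d.B.obj (op A')) :
    d.resK A ((d.B.map f.op).hom u) = Units.map ((d.base.map f).alg : d.fld A' →* d.fld A) (d.resK A' u) := by
  have n := congrArg (fun φ => φ.hom u) (d.toB0.naturality f.op)
  simp only [CommMonCat.hom_comp, MonoidHom.comp_apply] at n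
  exact n

/-- "The image of `p ∈ ℚ_p^×` in `K^×`" for the field `K = K_A` under `A ∈ Ob(D)` (FrdII, proof of
Thm. 1.2 (v), p. 10). [cite: MochizukiFrdII2008, Thm 1.2 (v) p.10] -/
def primeUnit (A : D) : (d.fld A)ˣ :=
  intNonzeroToUnits (d.fld A) ⟨((p : ℕ) : d.fld A), (d.base.obj A).p_mem⟩

/-- The value of `primeUnit` is `p`. [cite: MochizukiFrdII2008, Thm 1.2 (v) p.10] -/
@[simp] theorem coe_primeUnit (A : D) : (d.primeUnit A : d.fld A) = (p : ℕ) := rfl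

/-- Field homomorphisms fix `p`: the restriction maps of `B₀|_D` send `p ∈ K_{A'}^×` to `p ∈ K_A^×`.
[cite: MochizukiFrdII2008, Ex 1.1 (i) p.7] -/
theorem units_map_primeUnit {A A' : D} (f : A ⟶ A') :
    Units.map ((d.base.map f).alg : d.fld A' →* d.fld A) (d.primeUnit A') = d.primeUnit A :=
  Units.ext (by
    change (d.base.map f).alg ((p : ℕ) : d.fld A') = ((p : ℕ) : d.fld A)
    exact map_natCast _ p)

/-- `Div₀(p) = ord(p) ⊗ 1` in `Φ₀^gp(A)`: the generator of `ord(ℚ_p^×)`. [cite: MochizukiFrdII2008, Ex 1.1 (ii) p.8] -/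
theorem divZeroHom_primeUnit (A : D) :
    divZeroHom (d.fld A) (d.primeUnit A) =
      d.ordIntGp A (Associates.mk ⟨((p : ℕ) : d.fld A), (d.base.obj A).p_mem⟩) := by
  rw [primeUnit, divZeroHom_intNonzeroToUnits]
  rfl

/-- Powers of `v(p)` are injective in the exponent (`0 < v(p) < 1`). [cite: MochizukiFrdII2008, Ex 1.1 (i) p.7] -/
theorem valuation_primeUnit_pow_injective (A : D) :
    Injective fun m : ℕ => valuation (d.fld A) ((d.primeUnit A : d.fld A) ^ m) := by
  intro m n h
  simp only [map_pow, coe_primeUnit] at h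
  have h0 : valuation (d.fld A) ((p : ℕ) : d.fld A) ≠ 0 :=
    (Valuation.ne_zero_iff _).mpr (d.base.obj A).p_mem.2
  have h1 : valuation (d.fld A) ((p : ℕ) : d.fld A) < 1 := (d.base.obj A).p_lt
  exact (pow_right_strictAnti₀ (zero_lt_iff.mpr h0) h1).injective h

/-! ### Base-identity linear endomorphisms of the `p`-adic Frobenioid -/

/-- `End.asHom` turns products into composites (Mathlib's convention `f * g = g ≫ f`). [folklore] -/
private theorem asHom_mul {X : d.frobenioid} (a b : End X) : End.asHom (a * b) = End.asHom b ≫ End.asHom a :=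
  rfl

/-- `End.asHom 1 = 𝟙`. [folklore] -/
private theorem asHom_one (X : d.frobenioid) : End.asHom (1 : End X) = 𝟙 X := rfl

/-- For a base-identity linear endomorphism `e = (1, id, Div(e), u_e)` the relation (d) of [FrdI]
Thm. 5.2 (i) reads `Div(e) = Div_B(u_e)` in `Φ(A_D)^gp`. [cite: MochizukiFrdI2008, Thm. 5.2(i) p.100] -/
theorem of_div_eq_divB_unit {X : d.frobenioid} {e : X ⟶ X}
    (he : e ∈ PreFrobenioid.endSubmonoid d.structureFunctor X) :
    Algebra.GrothendieckGroup.of (ModelFrobenioid.div e) =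
      Frobenioids.divB d.Φ d.B d.divB (op X.base) (ModelFrobenioid.unit e) := by
  have h := ModelFrobenioid.rel e
  have h1 : ModelFrobenioid.baseMap e = 𝟙 X.base := he.1
  have h2 : ModelFrobenioid.degFr e = 1 := he.2
  rw [h1, h2, PNat.one_coe, pow_one, pullGp_id] at h
  exact mul_left_cancel h

/-- `unitEnd X z u h = (1, id, z, u)` is a base-identity linear endomorphism. [cite: MochizukiFrdI2008, Thm. 5.2(i) p.100] -/
theorem unitEnd_mem_endSubmonoid (X : d.frobenioid) (z : d.Φ.obj (op X.base)) (u : d.B.obj (op X.base))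
    (h : Algebra.GrothendieckGroup.of z = Frobenioids.divB d.Φ d.B d.divB (op X.base) u) :
    ModelFrobenioid.unitEnd X z u h ∈ PreFrobenioid.endSubmonoid d.structureFunctor X :=
  ⟨rfl, rfl⟩

/-- Composition in `O^▷(A)` multiplies rational functions: `u_{e ∘ e'} = u_e · u_{e'}`.
[cite: MochizukiFrdI2008, Thm. 5.2(i) p.100] -/
theorem unit_comp_of_mem {X : d.frobenioid} {e e' : X ⟶ X}
    (he : e ∈ PreFrobenioid.endSubmonoid d.structureFunctor X)
    (he' : e' ∈ PreFrobenioid.endSubmonoid d.structureFunctor X) :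
    ModelFrobenioid.unit (e' ≫ e) = ModelFrobenioid.unit e * ModelFrobenioid.unit e' := by
  have h1 : ModelFrobenioid.baseMap e' = 𝟙 X.base := he'.1
  have h2 : ModelFrobenioid.degFr e = 1 := he.2
  rw [ModelFrobenioid.unit_comp, h1, h2, PNat.one_coe, pow_one, ModelFrobenioid.map_id_apply_B]

/-- Composition in `O^▷(A)` multiplies zero divisors: `Div(e ∘ e') = Div(e) · Div(e')`.
[cite: MochizukiFrdI2008, Thm. 5.2(i) p.100] -/
theorem div_comp_of_mem {X : d.frobenioid} {e e' : X ⟶ X}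
    (he : e ∈ PreFrobenioid.endSubmonoid d.structureFunctor X)
    (he' : e' ∈ PreFrobenioid.endSubmonoid d.structureFunctor X) :
    ModelFrobenioid.div (e' ≫ e) = ModelFrobenioid.div e * ModelFrobenioid.div e' := by
  have h1 : ModelFrobenioid.baseMap e' = 𝟙 X.base := he'.1
  have h2 : ModelFrobenioid.degFr e = 1 := he.2
  rw [ModelFrobenioid.div_comp, h1, h2, PNat.one_coe, pow_one, ModelFrobenioid.map_id_apply_Φ]

/-- Two base-identity linear endomorphisms with the same rational function coincide (`Div` is
determined by `u` through relation (d), `Φ(A_D)` being cancellative). [cite: MochizukiFrdI2008, Thm. 5.2(i) p.100] -/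
theorem eq_of_mem_of_unit_eq {X : d.frobenioid} {e e' : X ⟶ X}
    (he : e ∈ PreFrobenioid.endSubmonoid d.structureFunctor X)
    (he' : e' ∈ PreFrobenioid.endSubmonoid d.structureFunctor X)
    (h : ModelFrobenioid.unit e = ModelFrobenioid.unit e') : e = e' := by
  haveI := (d.isMonoprime (op X.base)).isCancelMul
  have h1 : ModelFrobenioid.degFr e = 1 := he.2
  have h1' : ModelFrobenioid.degFr e' = 1 := he'.2
  have h2 : ModelFrobenioid.baseMap e = 𝟙 X.base := he.1
  have h2' : ModelFrobenioid.baseMap e' = 𝟙 X.base := he'.1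
  refine ModelFrobenioid.hom_ext (h1.trans h1'.symm) (h2.trans h2'.symm) ?_ h
  apply Algebra.GrothendieckGroup.of_injective
  rw [d.of_div_eq_divB_unit he, d.of_div_eq_divB_unit he', h]

/-- The rational function of a UNIT of the monoid `O^▷(A)` restricts to a unit of `O_{K_A}`, i.e. has
valuation `1` ("the kernel of `B → Φ^gp`", FrdII p. 9: its divisor is a unit of the sharp monoid `Φ(A_D)`,
hence trivial). [cite: MochizukiFrdII2008, Thm 1.2 (i) p.9] -/
theorem resK_unit_mem_unitSubgroup_of_isUnit {X : d.frobenioid}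
    {w : PreFrobenioid.endSubmonoid d.structureFunctor X} (hw : IsUnit w) :
    d.resK X.base (ModelFrobenioid.unit (End.asHom (w : End X))) ∈ unitSubgroup (d.fld X.base) := by
  obtain ⟨⟨inst, hfin, hc⟩⟩ := d.isPadicLocal X.base
  letI := inst
  haveI := hfin
  haveI := (d.isMonoprime (op X.base)).isCancelMul
  have hsharp : IsSharp (d.Φ.obj (op X.base)) := (d.isMonoprime (op X.base)).isSharp
  obtain ⟨w', hww'⟩ := hw.exists_right_inv
  -- `w' ≫ w = id`, hence `u_w · u_{w'} = 1`
  have h' : End.asHom ((w' : PreFrobenioid.endSubmonoid d.structureFunctor X) : End X) ≫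
      End.asHom ((w : PreFrobenioid.endSubmonoid d.structureFunctor X) : End X) = 𝟙 X := by
    rw [← asHom_mul, ← Submonoid.coe_mul, hww', Submonoid.coe_one, asHom_one]
  have hmul : ModelFrobenioid.unit (End.asHom (w : End X)) * ModelFrobenioid.unit (End.asHom (w' : End X)) = 1 := by
    rw [← d.unit_comp_of_mem (e := End.asHom (w : End X)) (e' := End.asHom (w' : End X)) w.2 w'.2, h',
      ModelFrobenioid.unit_id]
  -- `Div(w') · Div(w) = 0`, so `Div(w)` is a unit of the sharp monoid `Φ(A_D)`: `Div(w) = 0`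
  have hz1 : ModelFrobenioid.div (End.asHom (w' : End X)) * ModelFrobenioid.div (End.asHom (w : End X)) = 1 := by
    apply Algebra.GrothendieckGroup.of_injective
    rw [map_mul, d.of_div_eq_divB_unit (e := End.asHom (w' : End X)) w'.2,
      d.of_div_eq_divB_unit (e := End.asHom (w : End X)) w.2, ← map_mul, mul_comm, hmul, map_one, map_one]
  have hz : ModelFrobenioid.div (End.asHom (w : End X)) = 1 :=
    hsharp.1 _ (IsUnit.of_mul_eq_one_right _ hz1)
  have hdivB : Frobenioids.divB d.Φ d.B d.divB (op X.base) (ModelFrobenioid.unit (End.asHom (w : End X))) = 1 := by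
    rw [← d.of_div_eq_divB_unit (e := End.asHom (w : End X)) w.2, hz, map_one]
  -- `Div₀(u_w|_{K^×}) = ι^gp(Div_B(u_w)) = 0`, so `u_w|_{K^×} ∈ Ker(Div₀) = O_K^×`
  rw [← ker_divZeroHom_eq_unitSubgroup hc, MonoidHom.mem_ker, d.divZeroHom_resK, hdivB, map_one]

/-! ### The splitting `τ_p` -/

/-- `τ_p(A) ⊆ O^▷(A)` for an object `A = (A_D, α)` of the `p`-adic Frobenioid: the base-identity linear
endomorphisms whose rational function, restricted to `K_A^×`, is a power of the image of `p ∈ ℚ_p^×`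
("the image of `p ∈ ℚ_p^×` in `K^×` … determines a characteristic splitting", FrdII p. 10).
[cite: MochizukiFrdII2008, Thm 1.2 (v) p.10] -/
def pSplittingSubmonoid (X : d.frobenioid) : Submonoid (End X) where
  carrier := {e | e ∈ PreFrobenioid.endSubmonoid d.structureFunctor X ∧
    ∃ m : ℕ, d.resK X.base (ModelFrobenioid.unit (End.asHom e)) = d.primeUnit X.base ^ m}
  one_mem' := ⟨Submonoid.one_mem _, 0, by rw [pow_zero, asHom_one, ModelFrobenioid.unit_id, map_one]⟩
  mul_mem' := by
    rintro a b ⟨ha, m, hm⟩ ⟨hb, m', hm'⟩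
    refine ⟨Submonoid.mul_mem _ ha hb, m + m', ?_⟩
    rw [asHom_mul, d.unit_comp_of_mem (e := End.asHom a) (e' := End.asHom b) ha hb, map_mul, hm, hm', pow_add]

/-- Membership in `τ_p(A)`. [cite: MochizukiFrdII2008, Thm 1.2 (v) p.10] -/
theorem mem_pSplittingSubmonoid_iff {X : d.frobenioid} (e : End X) :
    e ∈ d.pSplittingSubmonoid X ↔ e ∈ PreFrobenioid.endSubmonoid d.structureFunctor X ∧
      ∃ m : ℕ, d.resK X.base (ModelFrobenioid.unit (End.asHom e)) = d.primeUnit X.base ^ m :=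
  Iff.rfl

/-- `τ_p(A) ⊆ O^▷(A)`. [cite: MochizukiFrdII2008, Thm 1.2 (v) p.10] -/
theorem pSplittingSubmonoid_le (X : d.frobenioid) :
    d.pSplittingSubmonoid X ≤ PreFrobenioid.endSubmonoid d.structureFunctor X := fun _ he => he.1

/-- **Subfunctoriality** ([FrdI] Def. 2.3, "subfunctor in monoids of `O^▷(−)` on `(C^istr)^lin`"): if
`φ : A → B` is linear, `β ∈ τ_p(B)`, `α ∈ O^▷(A)` and `β ∘ φ = φ ∘ α`, then `α ∈ τ_p(A)` — because
`u_α = B(Base φ)(u_β)` and field homomorphisms fix `p`. [cite: MochizukiFrdII2008, Thm 1.2 (v) p.10] -/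
theorem mem_pSplittingSubmonoid_of_comp_eq {X Y : d.frobenioid} (φ : X ⟶ Y)
    (hφ : PreFrobenioid.IsLinear d.structureFunctor φ) {β : End Y} (hβ : β ∈ d.pSplittingSubmonoid Y)
    {α : End X} (hα : α ∈ PreFrobenioid.endSubmonoid d.structureFunctor X)
    (h : φ ≫ End.asHom β = End.asHom α ≫ φ) : α ∈ d.pSplittingSubmonoid X := by
  obtain ⟨hβe, m, hm⟩ := hβ
  refine ⟨hα, m, ?_⟩
  have hu := congrArg ModelFrobenioid.unit h
  have hdφ : ModelFrobenioid.degFr φ = 1 := hφ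
  have hdβ : ModelFrobenioid.degFr (End.asHom β) = 1 := hβe.2
  have hbα : ModelFrobenioid.baseMap (End.asHom α) = 𝟙 X.base := hα.1
  rw [ModelFrobenioid.unit_comp, ModelFrobenioid.unit_comp, hdφ, hdβ, hbα, PNat.one_coe, pow_one,
    pow_one, ModelFrobenioid.map_id_apply_B,
    mul_comm (ModelFrobenioid.unit φ) (ModelFrobenioid.unit (End.asHom α))] at hu
  -- `hu : B(Base φ)(u_β) * u_φ = u_α * u_φ`; cancel the unit `u_φ`
  obtain ⟨c, hc⟩ := d.isUnit_B (op X.base) (ModelFrobenioid.unit φ)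
  rw [← hc] at hu
  have hu' : (d.B.map (ModelFrobenioid.baseMap φ).op).hom (ModelFrobenioid.unit (End.asHom β)) =
      ModelFrobenioid.unit (End.asHom α) := (Units.mul_left_inj c).mp hu
  rw [← hu', d.resK_mapB, hm, map_pow, d.units_map_primeUnit]

/-- **Compatibility with (isotropic hulls and, more generally, all) linear morphisms** ([FrdI]
Def. 2.3 (b)): for a linear `φ : A → B` and `β ∈ τ_p(B)`, the endomorphism
`α := (1, id, Φ(Base φ)(Div β), B(Base φ)(u_β))` of `A` satisfies `β ∘ φ = φ ∘ α`.
[cite: MochizukiFrdII2008, Thm 1.2 (v) p.10] -/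
theorem exists_comp_eq_of_isLinear {X Y : d.frobenioid} (φ : X ⟶ Y)
    (hφ : PreFrobenioid.IsLinear d.structureFunctor φ) {β : End Y} (hβ : β ∈ d.pSplittingSubmonoid Y) :
    ∃ α ∈ PreFrobenioid.endSubmonoid d.structureFunctor X, φ ≫ End.asHom β = End.asHom α ≫ φ := by
  have hβr := d.of_div_eq_divB_unit (e := End.asHom β) hβ.1
  have hdφ : ModelFrobenioid.degFr φ = 1 := hφ
  have hdβ : ModelFrobenioid.degFr (End.asHom β) = 1 := hβ.1.2
  have hbβ : ModelFrobenioid.baseMap (End.asHom β) = 𝟙 Y.base := hβ.1.1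
  refine ⟨End.of (ModelFrobenioid.unitEnd X
    ((d.Φ.map (ModelFrobenioid.baseMap φ).op).hom (ModelFrobenioid.div (End.asHom β)))
    ((d.B.map (ModelFrobenioid.baseMap φ).op).hom (ModelFrobenioid.unit (End.asHom β)))
    (ModelFrobenioid.of_map_eq_divB_map _ hβr)), d.unitEnd_mem_endSubmonoid X _ _ _,
    ModelFrobenioid.hom_ext ?_ ?_ ?_ ?_⟩
  · rw [ModelFrobenioid.degFr_comp, ModelFrobenioid.degFr_comp, hdβ, one_mul]
    exact (mul_one _).symm
  · rw [ModelFrobenioid.baseMap_comp, ModelFrobenioid.baseMap_comp, hbβ, Category.comp_id]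
    exact (Category.id_comp _).symm
  · rw [ModelFrobenioid.div_comp, ModelFrobenioid.div_comp, hdβ, hdφ, PNat.one_coe, pow_one, pow_one]
    change _ = (d.Φ.map (𝟙 X.base).op).hom (ModelFrobenioid.div φ) *
      (d.Φ.map (ModelFrobenioid.baseMap φ).op).hom (ModelFrobenioid.div (End.asHom β))
    rw [ModelFrobenioid.map_id_apply_Φ, mul_comm]
  · rw [ModelFrobenioid.unit_comp, ModelFrobenioid.unit_comp, hdβ, hdφ, PNat.one_coe, pow_one, pow_one]
    change _ = (d.B.map (𝟙 X.base).op).hom (ModelFrobenioid.unit φ) *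
      (d.B.map (ModelFrobenioid.baseMap φ).op).hom (ModelFrobenioid.unit (End.asHom β))
    rw [ModelFrobenioid.map_id_apply_B, mul_comm]

/-- **`τ_p(A) → O^▷(A)^char` is injective**: two elements of `τ_p(A)` that differ by a unit of `O^▷(A)`
have rational functions `p^m`, `p^{m'}` differing by a unit of `O_K`, so `m = m'` and the unit is trivial.
[cite: MochizukiFrdII2008, Thm 1.2 (v) p.10] -/
theorem eq_of_associated {X : d.frobenioid} {t t' : End X} (ht : t ∈ d.pSplittingSubmonoid X)
    (ht' : t' ∈ d.pSplittingSubmonoid X)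
    (h : Associated (⟨t, ht.1⟩ : PreFrobenioid.endSubmonoid d.structureFunctor X) ⟨t', ht'.1⟩) :
    t = t' := by
  obtain ⟨w, hw⟩ := h
  obtain ⟨m, hm⟩ := ht.2
  obtain ⟨m', hm'⟩ := ht'.2
  have hwK := d.resK_unit_mem_unitSubgroup_of_isUnit w.isUnit
  rw [mem_unitSubgroup_iff] at hwK
  -- `w ≫ t = t'`
  have hw2 : End.asHom ((w : PreFrobenioid.endSubmonoid d.structureFunctor X) : End X) ≫ End.asHom t =
      End.asHom t' := by
    have hw1 := congrArg (fun s : PreFrobenioid.endSubmonoid d.structureFunctor X => End.asHom (s : End X)) hw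
    simp only [Submonoid.coe_mul, asHom_mul] at hw1
    exact hw1
  -- rational functions: `p^m' = p^m · u_w|_{K^×}`
  have hprod : d.resK X.base (ModelFrobenioid.unit (End.asHom t')) =
      d.resK X.base (ModelFrobenioid.unit (End.asHom t)) *
        d.resK X.base (ModelFrobenioid.unit (End.asHom ((w : PreFrobenioid.endSubmonoid d.structureFunctor X) : End X))) := by
    rw [← hw2, d.unit_comp_of_mem (e := End.asHom t)
      (e' := End.asHom ((w : PreFrobenioid.endSubmonoid d.structureFunctor X) : End X)) ht.1
      (w : PreFrobenioid.endSubmonoid d.structureFunctor X).2, map_mul]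
  rw [hm, hm'] at hprod
  -- valuations: `v(p)^m' = v(p)^m`, so `m' = m`
  have hval := congrArg (fun x : (d.fld X.base)ˣ => valuation (d.fld X.base) (x : d.fld X.base)) hprod
  simp only [Units.val_mul, map_mul, hwK, mul_one] at hval
  have hmm : m' = m := d.valuation_primeUnit_pow_injective X.base (by
    simpa only [Units.val_pow_eq_pow_val] using hval)
  subst hmm
  -- hence `u_w|_{K^×} = 1` and `Div_B(u_w) = 0`, so `u_w = 1` and `w = id`
  have hw1 : d.resK X.base (ModelFrobenioid.unit
      (End.asHom ((w : PreFrobenioid.endSubmonoid d.structureFunctor X) : End X))) = 1 :=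
    mul_eq_left.mp hprod.symm
  have hunit : ModelFrobenioid.unit
      (End.asHom ((w : PreFrobenioid.endSubmonoid d.structureFunctor X) : End X)) = 1 := by
    refine d.resK_ext X.base ?_ ?_
    · rw [map_one]
      exact hw1
    · haveI := isCancelMul_realification (OrdInt (d.fld X.base))
      have hι : Injective (MonGp.map (d.ιHom X.base)) := MonGp.map_injective _ (d.ιHom_injective X.base)
      apply hι
      rw [← d.divZeroHom_resK, hw1, map_one, map_one, map_one]
  have hwid : End.asHom ((w : PreFrobenioid.endSubmonoid d.structureFunctor X) : End X) = 𝟙 X :=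
    d.eq_of_mem_of_unit_eq (e' := 𝟙 X) (w : PreFrobenioid.endSubmonoid d.structureFunctor X).2
      ⟨rfl, rfl⟩ (by rw [hunit, ModelFrobenioid.unit_id])
  rw [hwid, Category.id_comp] at hw2
  exact hw2

end Datum

end PadicFrd

end Literature.AlgebraicGeometry.Frobenioids
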